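import Mathlib
import HarnessLib
import Literature.Probability.LatticeModels.IsingConsistency
import Summits.CriticalPhenomena.Ising3DConformalLimit.Theorems.PlantedPinningPinningEfficiencyLeOne

/-!
# The one-pin variance drop with the Cauchy–Schwarz term kept
(route `PlantedPinning`, crux `PinningEfficiencyDeficit`, item stmt-CriticalPhenomena-8451: support, stub S2)

The exact one-pin variance drop behind the pinning-lemma ceiling `e ≤ 1`
(`PlantedPinningCeiling.pinning_lemma`, its step `hstepv`), with the two lossy steps
(Cauchy–Schwarz over the new pin, Jensen over pin sets and patterns) NOT applied:
with `n = |Λ|`, `w = w^{η₀}_Λ / Z^{η₀}_Λ`,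
`pvar k = (n choose k)⁻¹ ∑_{|P| = k} ∑_τ w(τ) Var^{τ ∨ η₀}_{Λ ∖ P}(M)` (`M = ∑_{x ∈ Λ} σ_x`) and
`csq j = (n choose j)⁻¹ ∑_{|P| = j} ∑_τ w(τ) (n − j) ∑_{z ∈ Λ ∖ P} Cov^{τ ∨ η₀}_{Λ ∖ P}(M, σ_z)²`,
`pvar (j+1) ≤ pvar j − csq j / (n − j)²` for `j < n` (`oneStepDrop_general`, any locally finite
graph, volume, `β`, `h`, fixed boundary condition; `stub_oneStepDrop` is the critical `+`-box on
`ℤ³`, literally the registered stub S2 of the birth line of the crux).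

Proof: in the abstract kernel framework of the pinning-lemma toolkit
(`PlantedPinningPinningEfficiencyLeOne*.lean`) the one-pin variance drop
`∑_ω w Cov(M, s_z | s|_P)² ≤ v(P) − v(P ∪ {z})` (`sum_condCov_sq_le_vbar_sub`) is summed over
`z ∈ Λ ∖ P` and `|P| = j`; double counting (`sum_powersetCard_sum_sdiff_insert`) and Pascal's rule
turn the right-hand side into `(n − j) (n choose j) (pvar j − pvar (j+1))` (`oneStepDrop_abstract`);
the finite-volume DLR identity `sum_kernel_isingWeight_eq` transports it to the planted Ising
ensemble exactly as in `pinning_efficiency_bounds`.  No definitions, no named facts.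
-/

namespace Summit.CriticalPhenomena.Ising3DConformalLimit.PlantedPinningDeficit

open Finset MeasureTheory Literature.Probability.LatticeModels
open Summit.CriticalPhenomena.Ising3DConformalLimit.PlantedPinningCeiling

/-! ### Abstract kernel framework -/

section Spins

variable {V Ω : Type*} [DecidableEq V] [Fintype Ω]

variable (w : Ω → ℝ) (s : V → Ω → ℝ) (Λ : Finset V)
  {K : Finset V → Ω → Ω → ℝ} {E : Finset V → (Ω → ℝ) → Ω → ℝ}
  (hK1 : ∀ P a b, (∀ x ∈ P, s x a = s x b) → K P a b = 1)
  (hK0 : ∀ P a b, ¬ (∀ x ∈ P, s x a = s x b) → K P a b = 0)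
  (hE : ∀ P f ω, E P f ω = (∑ ω', K P ω ω' * w ω' * f ω') / ∑ ω', K P ω ω' * w ω')

omit [DecidableEq V] [Fintype Ω] in
/-- The arithmetic of one pinning step: if `(j+1) C' = m C` (Pascal), `C, C', m > 0`, and
`B ≤ m A − (j+1) A'`, then `A'/C' ≤ A/C − (m B / C) / m²`. [folklore] -/
theorem drop_arith {A A' B C C' m jr : ℝ} (hC : 0 < C) (hm : 0 < m) (hj : 0 ≤ jr)
    (hpascal : (jr + 1) * C' = m * C) (key : B ≤ m * A - (jr + 1) * A') :
    A' / C' ≤ A / C - m * B / C / m ^ 2 := by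
  have hj1 : 0 < jr + 1 := by linarith
  have hC' : 0 < C' := by
    have : 0 < (jr + 1) * C' := by rw [hpascal]; exact mul_pos hm hC
    exact pos_of_mul_pos_right this hj1.le
  have h1 : A' / C' = ((jr + 1) * A') / (m * C) := by
    rw [← hpascal]
    field_simp
  have h2 : A / C - m * B / C / m ^ 2 = (m * A - B) / (m * C) := by
    field_simp
  rw [h1, h2]
  exact div_le_div_of_nonneg_right (by linarith) (mul_pos hm hC).le

include hK1 hK0 hE in
/-- **One-pin variance drop for a given pin set and new pin** (Raghavendra–Tan 2012, Lemma 4.3;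
Montanari 2008): `∑_ω w(ω) Cov(M, s_z | s|_P)(ω)² ≤ v(P) − v(P ∪ {z})`, where
`v(Q) = 𝔼_w Var(M | s|_Q)`; instance of `sum_condCov_sq_le_vbar_sub` for the agreement kernels
of `P ⊆ P ∪ {z}`. [folklore] -/
theorem condCov_sq_drop (hw : ∀ ω, 0 < w ω) (hs : ∀ x ω, s x ω ^ 2 = 1) (P : Finset V) (z : V)
    (M : Ω → ℝ) :
    ∑ ω, w ω * (E P (fun ω => M ω * s z ω) ω - E P M ω * E P (s z) ω) ^ 2 ≤
      ∑ ω, w ω * (E P (fun ω => M ω ^ 2) ω - (E P M ω) ^ 2) -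
        ∑ ω, w ω * (E (insert z P) (fun ω => M ω ^ 2) ω - (E (insert z P) M ω) ^ 2) := by
  obtain ⟨_, h01, hrefl, hsymm, htrans⟩ := agreeKernel_props s hK1 hK0 P
  obtain ⟨hiff', h01', hrefl', hsymm', htrans'⟩ := agreeKernel_props s hK1 hK0 (insert z P)
  have href : ∀ a b, K (insert z P) a b = 1 → K P a b = 1 := fun a b hab =>
    hK1 P a b fun x hx => (hiff' a b).1 hab x (Finset.mem_insert_of_mem hx)
  have hsinv : ∀ a b, K (insert z P) a b = 1 → s z a = s z b := fun a b hab =>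
    (hiff' a b).1 hab z (Finset.mem_insert_self z P)
  exact sum_condCov_sq_le_vbar_sub w (K P) (K (insert z P)) (hE P) (hE (insert z P)) hw
    h01 hrefl hsymm htrans h01' hrefl' hsymm' htrans' href M (s z) (hs z) hsinv

include hK1 hK0 hE in
/-- **One step of the pinning flow with the Cauchy–Schwarz term kept**, abstract finite form:
with `v(Q) = 𝔼_w Var(M | s|_Q)`, `pvar k = (n choose k)⁻¹ ∑_{|Q| = k} v(Q)` and
`csq j = (n choose j)⁻¹ ∑_{|P| = j} 𝔼_w[(n − j) ∑_{z ∈ Λ ∖ P} Cov(M, s_z | s|_P)²]`, for `j < n = |Λ|`,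
`pvar (j+1) ≤ pvar j − csq j / (n − j)²` (one-pin variance drop summed over the new pin and the
pin sets, double counting, Pascal; Raghavendra–Tan 2012, proof of Lemma 4.3, before
Cauchy–Schwarz/Jensen). [folklore] -/
theorem oneStepDrop_abstract (hw : ∀ ω, 0 < w ω) (hs : ∀ x ω, s x ω ^ 2 = 1) (M : Ω → ℝ)
    {j : ℕ} (hj : j < #Λ) :
    (∑ Q ∈ Λ.powersetCard (j + 1), ∑ ω, w ω * (E Q (fun ω => M ω ^ 2) ω - (E Q M ω) ^ 2)) /
        ((#Λ).choose (j + 1) : ℝ) ≤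
      (∑ P ∈ Λ.powersetCard j, ∑ ω, w ω * (E P (fun ω => M ω ^ 2) ω - (E P M ω) ^ 2)) /
          ((#Λ).choose j : ℝ) -
        (∑ P ∈ Λ.powersetCard j, ∑ ω, w ω * (((#Λ : ℝ) - j) *
            ∑ z ∈ Λ \ P, (E P (fun ω => M ω * s z ω) ω - E P M ω * E P (s z) ω) ^ 2)) /
          ((#Λ).choose j : ℝ) / ((#Λ : ℝ) - j) ^ 2 := by
  set n := #Λ with hn
  -- `vb Q = 𝔼 Var(M | s|_Q)`, `S P = ∑_{z ∉ P} 𝔼 Cov(M, s_z | s|_P)²`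
  set vb : Finset V → ℝ := fun Q => ∑ ω, w ω * (E Q (fun ω => M ω ^ 2) ω - (E Q M ω) ^ 2)
    with hvb
  set Cz : Finset V → V → Ω → ℝ := fun P z ω =>
    E P (fun ω => M ω * s z ω) ω - E P M ω * E P (s z) ω with hCz
  set S : Finset V → ℝ := fun P => ∑ z ∈ Λ \ P, ∑ ω, w ω * (Cz P z ω) ^ 2 with hS
  set A := ∑ P ∈ Λ.powersetCard j, vb P with hA
  set A' := ∑ Q ∈ Λ.powersetCard (j + 1), vb Q with hA'
  set B := ∑ P ∈ Λ.powersetCard j, S P with hB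
  set Cj : ℝ := (n.choose j : ℝ) with hCj
  set Cj' : ℝ := (n.choose (j + 1) : ℝ) with hCj'
  set m : ℝ := (n : ℝ) - j with hm
  have hCpos : 0 < Cj := by rw [hCj]; exact_mod_cast Nat.choose_pos hj.le
  have hmpos : 0 < m := by
    have : (j : ℝ) + 1 ≤ n := by exact_mod_cast hj
    rw [hm]; linarith
  -- Pascal: `(j+1) C' = m C`
  have hpascal : ((j : ℝ) + 1) * Cj' = m * Cj := by
    have h := Nat.choose_succ_right_eq n j
    have hcast : ((n - j : ℕ) : ℝ) = (n : ℝ) - j := Nat.cast_sub hj.le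
    rw [hCj', hCj, hm, ← hcast]
    exact_mod_cast (by rw [mul_comm] at h; linarith [h] :
      (j + 1) * n.choose (j + 1) = (n - j) * n.choose j)
  have hcardT : ∀ P ∈ Λ.powersetCard j, (#(Λ \ P) : ℝ) = m := by
    intro P hP
    obtain ⟨hPΛ, hPc⟩ := Finset.mem_powersetCard.1 hP
    rw [Finset.card_sdiff_of_subset hPΛ, hPc, Nat.cast_sub hj.le, hm]
  -- the summed one-pin drop: `B ≤ m A − (j+1) A'`
  have hsum1 : B ≤ ∑ P ∈ Λ.powersetCard j, ∑ z ∈ Λ \ P, (vb P - vb (insert z P)) := by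
    refine Finset.sum_le_sum fun P _ => Finset.sum_le_sum fun z _ => ?_
    exact condCov_sq_drop w s hK1 hK0 hE hw hs P z M
  have hrhs : ∑ P ∈ Λ.powersetCard j, ∑ z ∈ Λ \ P, (vb P - vb (insert z P)) =
      m * A - ((j : ℝ) + 1) * A' := by
    have hin : ∀ P ∈ Λ.powersetCard j, ∑ z ∈ Λ \ P, (vb P - vb (insert z P)) =
        m * vb P - ∑ z ∈ Λ \ P, vb (insert z P) := fun P hP => by
      rw [Finset.sum_sub_distrib, Finset.sum_const, nsmul_eq_mul, hcardT P hP]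
    rw [Finset.sum_congr rfl hin, Finset.sum_sub_distrib, ← Finset.mul_sum,
      sum_powersetCard_sum_sdiff_insert Λ j vb]
  have key : B ≤ m * A - ((j : ℝ) + 1) * A' := hsum1.trans hrhs.le
  -- the `csq` numerator is `m B`
  have hcsq : ∑ P ∈ Λ.powersetCard j, ∑ ω, w ω * (m * ∑ z ∈ Λ \ P, (Cz P z ω) ^ 2) = m * B := by
    rw [hB, Finset.mul_sum]
    refine Finset.sum_congr rfl fun P _ => ?_
    rw [hS]
    simp only
    have h1 : ∑ z ∈ Λ \ P, ∑ ω, w ω * Cz P z ω ^ 2 = ∑ ω, ∑ z ∈ Λ \ P, w ω * Cz P z ω ^ 2 :=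
      Finset.sum_comm
    rw [h1, Finset.mul_sum]
    refine Finset.sum_congr rfl fun ω _ => ?_
    simp only [Finset.mul_sum]
    exact Finset.sum_congr rfl fun z _ => by ring
  rw [hcsq]
  exact drop_arith hCpos hmpos (Nat.cast_nonneg j) hpascal key

end Spins

/-! ### The planted Ising ensemble -/

/-- **One-pin drop with the Cauchy–Schwarz term kept, finite-volume Ising model** on any locally
finite graph, any volume `Λ` (`n = |Λ|`), any `β, h` and any fixed boundary condition `η₀`:
with `w = w^{η₀}_Λ / Z^{η₀}_Λ`, `M = ∑_{x ∈ Λ} σ_x`,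
`pvar k = (n choose k)⁻¹ ∑_{|P| = k} ∑_τ w(τ) Var^{τ ∨ η₀}_{Λ ∖ P}(M)` and
`csq j = (n choose j)⁻¹ ∑_{|P| = j} ∑_τ w(τ) (n − j) ∑_{z ∈ Λ ∖ P} Cov^{τ ∨ η₀}_{Λ ∖ P}(M, σ_z)²`,
`pvar (j+1) ≤ pvar j − csq j / (n − j)²` for `j < n` (pinning flow: Montanari 2008,
arXiv:0709.0145; Raghavendra–Tan 2012, Lemma 4.3; finite-volume DLR: Friedli–Velenik 2017,
Lemma 6.7).  `oneStepDrop_abstract` transported through `sum_kernel_isingWeight_eq`. [folklore] -/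
theorem oneStepDrop_general {V : Type*} [DecidableEq V] (G : SimpleGraph V) [G.LocallyFinite]
    (Λ : Finset V) (β h : ℝ) (η₀ : SpinConfig V) {j : ℕ} (hj : j < #Λ) :
    (∑ P ∈ Λ.powersetCard (j + 1), ∑ τ : Λ → ℤˣ,
        isingWeight G Λ β h (.fixed η₀) τ / isingPartitionFunction G Λ β h (.fixed η₀) *
          (isingExpect G (Λ \ P) β h (.fixed (glue Λ τ (.fixed η₀)))
              (fun σ => (∑ x ∈ Λ, spinAt x σ) ^ 2) -
            isingExpect G (Λ \ P) β h (.fixed (glue Λ τ (.fixed η₀)))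
              (fun σ => ∑ x ∈ Λ, spinAt x σ) ^ 2)) / ((#Λ).choose (j + 1) : ℝ) ≤
      (∑ P ∈ Λ.powersetCard j, ∑ τ : Λ → ℤˣ,
        isingWeight G Λ β h (.fixed η₀) τ / isingPartitionFunction G Λ β h (.fixed η₀) *
          (isingExpect G (Λ \ P) β h (.fixed (glue Λ τ (.fixed η₀)))
              (fun σ => (∑ x ∈ Λ, spinAt x σ) ^ 2) -
            isingExpect G (Λ \ P) β h (.fixed (glue Λ τ (.fixed η₀)))
              (fun σ => ∑ x ∈ Λ, spinAt x σ) ^ 2)) / ((#Λ).choose j : ℝ) -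
        (∑ P ∈ Λ.powersetCard j, ∑ τ : Λ → ℤˣ,
          isingWeight G Λ β h (.fixed η₀) τ / isingPartitionFunction G Λ β h (.fixed η₀) *
            ((((#Λ : ℕ) : ℝ) - j) * ∑ z ∈ Λ \ P,
              (isingExpect G (Λ \ P) β h (.fixed (glue Λ τ (.fixed η₀)))
                  (fun σ => (∑ x ∈ Λ, spinAt x σ) * spinAt z σ) -
                isingExpect G (Λ \ P) β h (.fixed (glue Λ τ (.fixed η₀)))
                  (fun σ => ∑ x ∈ Λ, spinAt x σ) *
                isingExpect G (Λ \ P) β h (.fixed (glue Λ τ (.fixed η₀)))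
                  (fun σ => spinAt z σ)) ^ 2)) / ((#Λ).choose j : ℝ) /
          (((#Λ : ℕ) : ℝ) - j) ^ 2 := by
  classical
  -- weights `w = w^{η₀}_Λ / Z`
  set W : (Λ → ℤˣ) → ℝ := isingWeight G Λ β h (.fixed η₀) with hW
  set Z : ℝ := isingPartitionFunction G Λ β h (.fixed η₀) with hZ
  have hZpos : 0 < Z := isingPartitionFunction_pos G Λ β h (.fixed η₀)
  set w : (Λ → ℤˣ) → ℝ := fun τ => W τ / Z with hw
  have hwpos : ∀ τ, 0 < w τ := fun τ => div_pos (isingWeight_pos G Λ β h _ τ) hZpos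
  -- spins `s x τ = (τ ∨ η₀)_x`
  set s : V → (Λ → ℤˣ) → ℝ := fun x τ => spinAt x (glue Λ τ (.fixed η₀)) with hs
  have hs1 : ∀ x τ, s x τ ^ 2 = 1 := fun x τ => spinAt_sq x _
  -- agreement kernels and conditional expectations given the spins on `P`
  set K : Finset V → (Λ → ℤˣ) → (Λ → ℤˣ) → ℝ :=
    fun P a b => if ∀ x ∈ P, s x a = s x b then 1 else 0 with hK
  have hK1 : ∀ P a b, (∀ x ∈ P, s x a = s x b) → K P a b = 1 := fun P a b hab => by
    simp only [hK, if_pos hab]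
  have hK0 : ∀ P a b, ¬ (∀ x ∈ P, s x a = s x b) → K P a b = 0 := fun P a b hab => by
    simp only [hK, if_neg hab]
  set E : Finset V → ((Λ → ℤˣ) → ℝ) → (Λ → ℤˣ) → ℝ :=
    fun P g τ => (∑ σ, K P τ σ * w σ * g σ) / ∑ σ, K P τ σ * w σ with hE
  have hEeq : ∀ P g τ, E P g τ = (∑ σ, K P τ σ * w σ * g σ) / ∑ σ, K P τ σ * w σ :=
    fun _ _ _ => rfl
  set Mt : (Λ → ℤˣ) → ℝ := fun τ => ∑ x ∈ Λ, s x τ with hMt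
  -- the abstract one-step drop
  have hmain := oneStepDrop_abstract w s Λ hK1 hK0 hEeq hwpos hs1 Mt hj
  -- DLR: planted conditional moments are conditional moments given the spins on `P`
  have hm1 : Measurable (fun σ : SpinConfig V => ∑ x ∈ Λ, spinAt x σ) :=
    Finset.measurable_sum _ fun x _ => measurable_spinAt x
  have hm2 : Measurable (fun σ : SpinConfig V => (∑ x ∈ Λ, spinAt x σ) ^ 2) := hm1.pow_const 2
  have hm3 : ∀ z : V, Measurable (fun σ : SpinConfig V => (∑ x ∈ Λ, spinAt x σ) * spinAt z σ) :=
    fun z => hm1.mul (measurable_spinAt z)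
  have hm4 : ∀ z : V, Measurable (fun σ : SpinConfig V => spinAt z σ) := fun z =>
    measurable_spinAt z
  have key : ∀ P, P ⊆ Λ → ∀ τ : Λ → ℤˣ, ∀ {f : SpinConfig V → ℝ}, Measurable f →
      E P (fun σ => f (glue Λ σ (.fixed η₀))) τ =
        isingExpect G (Λ \ P) β h (.fixed (glue Λ τ (.fixed η₀))) f := by
    intro P hP τ f hf
    obtain ⟨_, h01, hrefl, _, _⟩ := agreeKernel_props s hK1 hK0 P
    have hKW : 0 < ∑ σ, K P τ σ * W σ :=
      ksum_one_pos W (K P) (fun σ => isingWeight_pos G Λ β h _ σ) h01 hrefl τ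
    have hdlr := sum_kernel_isingWeight_eq G hP β h η₀ (K := K P) (hK1 P) (hK0 P) τ hf
    have h1 : ∑ σ, K P τ σ * w σ * f (glue Λ σ (.fixed η₀)) =
        (∑ σ, K P τ σ * W σ * f (glue Λ σ (.fixed η₀))) / Z := by
      rw [Finset.sum_div]
      exact Finset.sum_congr rfl fun σ _ => by simp only [hw]; ring
    have h2 : ∑ σ, K P τ σ * w σ = (∑ σ, K P τ σ * W σ) / Z := by
      rw [Finset.sum_div]
      exact Finset.sum_congr rfl fun σ _ => by simp only [hw]; ring
    rw [hEeq, h1, h2, div_div_div_cancel_right₀ hZpos.ne', hdlr, mul_div_cancel_left₀ _ hKW.ne']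
  have hcv : ∀ P, P ⊆ Λ → ∀ τ : Λ → ℤˣ,
      isingExpect G (Λ \ P) β h (.fixed (glue Λ τ (.fixed η₀))) (fun σ => (∑ x ∈ Λ, spinAt x σ) ^ 2) -
        isingExpect G (Λ \ P) β h (.fixed (glue Λ τ (.fixed η₀))) (fun σ => ∑ x ∈ Λ, spinAt x σ) ^ 2 =
      E P (fun τ => Mt τ ^ 2) τ - (E P Mt τ) ^ 2 := by
    intro P hP τ
    rw [← key P hP τ hm1, ← key P hP τ hm2]
  have hcc : ∀ P, P ⊆ Λ → ∀ (τ : Λ → ℤˣ) (z : V),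
      isingExpect G (Λ \ P) β h (.fixed (glue Λ τ (.fixed η₀)))
          (fun σ => (∑ x ∈ Λ, spinAt x σ) * spinAt z σ) -
        isingExpect G (Λ \ P) β h (.fixed (glue Λ τ (.fixed η₀))) (fun σ => ∑ x ∈ Λ, spinAt x σ) *
          isingExpect G (Λ \ P) β h (.fixed (glue Λ τ (.fixed η₀))) (fun σ => spinAt z σ) =
      E P (fun τ => Mt τ * s z τ) τ - E P Mt τ * E P (s z) τ := by
    intro P hP τ z
    rw [← key P hP τ hm1, ← key P hP τ (hm3 z), ← key P hP τ (hm4 z)]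
  have hsum : ∀ k, ∑ P ∈ Λ.powersetCard k, ∑ τ : Λ → ℤˣ, W τ / Z *
        (isingExpect G (Λ \ P) β h (.fixed (glue Λ τ (.fixed η₀))) (fun σ => (∑ x ∈ Λ, spinAt x σ) ^ 2) -
          isingExpect G (Λ \ P) β h (.fixed (glue Λ τ (.fixed η₀))) (fun σ => ∑ x ∈ Λ, spinAt x σ) ^ 2) =
      ∑ P ∈ Λ.powersetCard k, ∑ τ, w τ * (E P (fun τ => Mt τ ^ 2) τ - (E P Mt τ) ^ 2) :=
    fun k => Finset.sum_congr rfl fun P hP => Finset.sum_congr rfl fun τ _ => by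
      rw [hcv P (Finset.mem_powersetCard.1 hP).1 τ]
  have hsumc : ∑ P ∈ Λ.powersetCard j, ∑ τ : Λ → ℤˣ, W τ / Z *
        ((((#Λ : ℕ) : ℝ) - j) * ∑ z ∈ Λ \ P,
          (isingExpect G (Λ \ P) β h (.fixed (glue Λ τ (.fixed η₀)))
              (fun σ => (∑ x ∈ Λ, spinAt x σ) * spinAt z σ) -
            isingExpect G (Λ \ P) β h (.fixed (glue Λ τ (.fixed η₀)))
              (fun σ => ∑ x ∈ Λ, spinAt x σ) *
            isingExpect G (Λ \ P) β h (.fixed (glue Λ τ (.fixed η₀)))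
              (fun σ => spinAt z σ)) ^ 2) =
      ∑ P ∈ Λ.powersetCard j, ∑ τ, w τ * ((((#Λ : ℕ) : ℝ) - j) *
        ∑ z ∈ Λ \ P, (E P (fun τ => Mt τ * s z τ) τ - E P Mt τ * E P (s z) τ) ^ 2) :=
    Finset.sum_congr rfl fun P hP => Finset.sum_congr rfl fun τ _ => by
      rw [Finset.sum_congr rfl fun z _ => by rw [hcc P (Finset.mem_powersetCard.1 hP).1 τ z]]
  rw [hsum (j + 1), hsum j, hsumc]
  exact hmain

/-- **S2 `stub_oneStepDrop`** of the birth line of the crux `PinningEfficiencyDeficit`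
(item stmt-CriticalPhenomena-8451): for the critical (`β = β_c(3)`, `h = 0`, `+` boundary
condition) Ising box `Λ_L = box 3 L` on `ℤ³`, `n = |Λ_L|`, every `L` and every `j < n`,
`pvar L (j+1) ≤ pvar L j − csq L j / (n − j)²`: the exact one-pin variance drop of the planted
pinning flow with the Cauchy–Schwarz functional `csq` kept.  Instance of `oneStepDrop_general`
(Montanari 2008; Raghavendra–Tan 2012; Friedli–Velenik 2017, Lemma 6.7). [folklore] -/
theorem stub_oneStepDrop : (fun (βc : ℝ) (M : ℕ → Literature.Probability.LatticeModels.SpinConfig (Literature.Probability.LatticeModels.Site 3) → ℝ) => (fun (pvar csq : ℕ → ℕ → ℝ) => ∀ L j : ℕ, j < (Literature.Probability.LatticeModels.box 3 L).card → pvar L (j + 1) ≤ pvar L j - csq L j / (((Literature.Probability.LatticeModels.box 3 L).card : ℝ) - j) ^ 2) (fun (L k : ℕ) => (∑ P ∈ (Literature.Probability.LatticeModels.box 3 L).powersetCard k, ∑ τ : ↥(Literature.Probability.LatticeModels.box 3 L) → ℤˣ, Literature.Probability.LatticeModels.isingWeight (Literature.Probability.LatticeModels.zdGraph 3) (Literature.Probability.LatticeModels.box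 3 L) βc 0 .plus τ / Literature.Probability.LatticeModels.isingPartitionFunction (Literature.Probability.LatticeModels.zdGraph 3) (Literature.Probability.LatticeModels.box 3 L) βc 0 .plus * (Literature.Probability.LatticeModels.isingExpect (Literature.Probability.LatticeModels.zdGraph 3) (Literature.Probability.LatticeModels.box 3 L \ P) βc 0 (.fixed (Literature.Probability.LatticeModels.glue (Literature.Probability.LatticeModels.box 3 L) τ .plus)) (fun σ => M L σ ^ 2) - Literature.Probability.LatticeModels.isingExpect (Literature.Probability.LatticeModels.zdGraph 3) (Literature.Probability.LatticeModels.box 3 L \ P) βc 0 (.fixed (Literature.Probability.LatticeModels.glue (Literature.Probability.LatticeModels.box 3 L) τ .plus)) (M L) ^ 2)) / ((Literature.Probability.LatticeModels.box 3 L).card.choose k : ℝ)) (fun (L j : ℕ) => (∑ P ∈ (Literature.Probability.LatticeModels.box 3 L).powersetCard j, ∑ τ : ↥(Literature.Probability.LatticeModels.box 3 L) → ℤˣ, Literature.Probability.LatticeModels.isingWeight (Literature.Probability.LatticeModels.zdGraph 3) (Literature.Probability.LatticeModels.box 3 L) βc 0 .plus τ / Literature.Probability.LatticeModels.isingPartitionFunction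 (Literature.Probability.LatticeModels.zdGraph 3) (Literature.Probability.LatticeModels.box 3 L) βc 0 .plus * ((((Literature.Probability.LatticeModels.box 3 L).card : ℝ) - j) * ∑ z ∈ Literature.Probability.LatticeModels.box 3 L \ P, (Literature.Probability.LatticeModels.isingExpect (Literature.Probability.LatticeModels.zdGraph 3) (Literature.Probability.LatticeModels.box 3 L \ P) βc 0 (.fixed (Literature.Probability.LatticeModels.glue (Literature.Probability.LatticeModels.box 3 L) τ .plus)) (fun σ => M L σ * Literature.Probability.LatticeModels.spinAt z σ) - Literature.Probability.LatticeModels.isingExpect (Literature.Probability.LatticeModels.zdGraph 3) (Literature.Probability.LatticeModels.box 3 L \ P) βc 0 (.fixed (Literature.Probability.LatticeModels.glue (Literature.Probability.LatticeModels.box 3 L) τ .plus)) (M L) * Literature.Probability.LatticeModels.isingExpect (Literature.Probability.LatticeModels.zdGraph 3) (Literature.Probability.LatticeModels.box 3 L \ P) βc 0 (.fixed (Literature.Probability.LatticeModels.glue (Literature.Probability.LatticeModels.box 3 L) τ .plus)) (fun σ => Literature.Probability.LatticeModels.spinAt z σ)) ^ 2)) / ((Literature.Probability.LatticeModels.box 3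 L).card.choose j : ℝ))) (Literature.Probability.LatticeModels.criticalBeta 3) (fun (L : ℕ) (σ : Literature.Probability.LatticeModels.SpinConfig (Literature.Probability.LatticeModels.Site 3)) => ∑ x ∈ Literature.Probability.LatticeModels.box 3 L, Literature.Probability.LatticeModels.spinAt x σ) := by
  intro L j hj
  exact oneStepDrop_general (zdGraph 3) (box 3 L) (criticalBeta 3) 0 1 hj

end Summit.CriticalPhenomena.Ising3DConformalLimit.PlantedPinningDeficit
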